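import Literature.Computability.MetaComplexity.XorPHPLowerBound
import Mathlib.Logic.Equiv.Fin.Basic
import Mathlib.Algebra.Group.Fin.Basic
import HarnessLib

/-!
# An unconditional bounded-depth Frege lower bound for Tseitin formulas on torus grids

Application of the PHP-labelling reduction (`XorPHPLowerBound.lean`,
`OntoPHPReduction.depthFrege_lowerBound_of_sound_label`): the Tseitin contradiction of the
`(N+2) × (N+1)` torus grid (vertices `(r, c)`, `r ∈ ℤ/(N+2)`, `c ∈ ℤ/(N+1)`, horizontal edges
`(r,c)–(r,c+1)` and vertical edges `(r,c)–(r+1,c)`, charge `1` at the `2N + 1` vertices `(r, 0)`,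
`r ≠ 0`, and `(0, c)`, `c ≠ 0`), written as a `4`-sparse XOR system `TorusGrid.sys N` and encoded
by `sumEncoding 1`, requires depth-`d` `textbookFrege`-proofs of size `2^{N^{ε_d}}`
(`TorusGrid.depthFrege_lowerBound`) — with NO unproved hypothesis.

The sound labelling (`TorusGrid.lab`): rows are pigeon walks and columns are hole walks. Pigeon
`b ≤ N` starts at `(b+1, 0)` and walks right along row `b + 1`; hole `a < N` starts at `(0, a+1)`
and walks down column `a + 1`; they meet at `(b+1, a+1)`. Accordingly the horizontal edge
`(r, c)–(r, c+1)`, `r ≠ 0`, carries the pigeon-star `(r - 1, {c, …, N-1})` ("pigeon `r-1` still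
walks at column `c`, i.e. its hole is `≥ c`") and the vertical edge `(r, c)–(r+1, c)`, `c ≠ 0`, the
hole-star `(c - 1, {r, …, N})`; row `0`, column `0` and the wrap-around edges carry nothing
(empty stars). At an inner vertex the four incident stars telescope to
`[f(r-1) = c-1] ⊕ [g(c-1) = r-1] = 0` by local consistency; at a pigeon terminal `(r, 0)` to
`[f(r-1) < N] = 1`; at a hole terminal `(0, c)` to `[g(c-1) ≤ N] = 1`.

This is the weak-exponent form of Håstad's theorem (J. ACM 2020: depth-`d` Frege proofs of
Tseitin on the `n × n` grid require size `2^{n^{Ω(1/d)}}`; here `2^{n^{ε_d}}` with the exponent of the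
tree's Ajtai theorem), obtained by Ben-Sasson's method (Comput. Complexity 2002) instead of a
switching lemma.

References: J. Håstad, *On small-depth Frege proofs for Tseitin for grids*, J. ACM 68 (2020),
Thm. 6.2 (the statement, stronger exponent); E. Ben-Sasson, *Hard examples for the bounded depth
Frege proof system*, Comput. Complexity 11 (2002) (the method); J. Krajíček, *Proof complexity*,
CUP 2019, §13.3 (Tseitin formulas), §15.4, p. 431.
-/

namespace Literature.Computability.MetaComplexity

open Complexity Complexity.PropForm Finset

namespace OntoPHPReduction

namespace TorusGrid

/-! ### The torus grid and its Tseitin system -/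

section Defs

variable (N : ℕ)

/-- The vertices of the `(N+2) × (N+1)` torus: (row, column). [folklore] -/
abbrev Vtx : Type := Fin (N + 2) × Fin (N + 1)

/-- Number of vertices. [folklore] -/
abbrev nV : ℕ := (N + 2) * (N + 1)

/-- Number of edges (horizontal and vertical). [folklore] -/
abbrev nE : ℕ := 2 * ((N + 2) * (N + 1))

/-- Decoding a vertex index. [folklore] -/
def vtx : Fin (nV N) ≃ Vtx N :=
  finProdFinEquiv.symm

/-- Decoding an edge index: tag `0` = the horizontal edge `(r,c)–(r,c+1)`, tag `1` = the vertical
edge `(r,c)–(r+1,c)`, at the vertex `(r, c)`. [folklore] -/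
def edg : Fin (nE N) ≃ Fin 2 × Vtx N :=
  finProdFinEquiv.symm.trans (Equiv.prodCongr (Equiv.refl _) finProdFinEquiv.symm)

/-- The horizontal edge leaving `p` to the right. [folklore] -/
def hEdge (p : Vtx N) : Fin (nE N) :=
  (edg N).symm (0, p)

/-- The vertical edge leaving `p` downwards. [folklore] -/
def vEdge (p : Vtx N) : Fin (nE N) :=
  (edg N).symm (1, p)

/-- The four edges at a vertex (right, left, down, up; torus arithmetic). [folklore] -/
def inc (p : Vtx N) : Finset (Fin (nE N)) :=
  {hEdge N p, hEdge N (p.1, p.2 - 1), vEdge N p, vEdge N (p.1 - 1, p.2)}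

/-- The charge: `1` at the pigeon terminals `(r, 0)`, `r ≠ 0`, and the hole terminals `(0, c)`,
`c ≠ 0` (an odd number, `2N + 1`, of odd charges). [cite: KrajicekProofComplexity2019, §13.3 (Tseitin formulas)] -/
def chgB (p : Vtx N) : Bool :=
  (decide (p.1 ≠ 0) && decide (p.2 = 0)) || (decide (p.1 = 0) && decide (p.2 ≠ 0))

/-- **The Tseitin XOR system of the charged torus grid**: one parity constraint per vertex over its
four incident edges. [cite: KrajicekProofComplexity2019, §13.3 (Tseitin formulas as linear systems over F₂)] -/
def sys : Fin (nV N) → LinEqMod 2 (nE N) := fun i =>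
  (fun j => if j ∈ inc N (vtx N i) then 1 else 0, if chgB N (vtx N i) then 1 else 0)

/-- **The labelling**: horizontal edges of row `r ≠ 0` carry the pigeon-star of pigeon `r - 1`
with the holes `{c, …, N-1}`, vertical edges of column `c ≠ 0` the hole-star of hole `c - 1` with
the pigeons `{r, …, N}`. [cite: KrajicekProofComplexity2019, §15.4 (the substitution of a reduction to ontoPHP)] -/
def lab : PHPLabel where
  c := fun _ => false
  ps := fun j =>
    if h : j < nE N then
      (if (edg N ⟨j, h⟩).1 = 0 ∧ (edg N ⟨j, h⟩).2.1 ≠ 0 then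
        some ((edg N ⟨j, h⟩).2.1.val - 1, Finset.Ico (edg N ⟨j, h⟩).2.2.val N) else none)
    else none
  hs := fun j =>
    if h : j < nE N then
      (if (edg N ⟨j, h⟩).1 = 1 ∧ (edg N ⟨j, h⟩).2.2 ≠ 0 then
        some ((edg N ⟨j, h⟩).2.2.val - 1, Finset.Icc (edg N ⟨j, h⟩).2.1.val N) else none)
    else none

end Defs

variable {N : ℕ}

/-! ### Decoding the labels of the edges -/

/-- Decoding a horizontal edge. [folklore] -/
@[simp] theorem edg_hEdge (p : Vtx N) : edg N (hEdge N p) = (0, p) := by simp [hEdge]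

/-- Decoding a vertical edge. [folklore] -/
@[simp] theorem edg_vEdge (p : Vtx N) : edg N (vEdge N p) = (1, p) := by simp [vEdge]

/-- Re-packing an edge index. [folklore] -/
theorem fin_eta (e : Fin (nE N)) (h : e.val < nE N) : (⟨e.val, h⟩ : Fin (nE N)) = e := Fin.eta e h

/-- The pigeon-star of a horizontal edge. [folklore] -/
theorem ps_hEdge (p : Vtx N) :
    (lab N).ps (hEdge N p).val = if p.1 ≠ 0 then some (p.1.val - 1, Finset.Ico p.2.val N) else none := by
  simp only [lab, (hEdge N p).isLt, dif_pos, fin_eta, edg_hEdge, true_and]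

/-- Horizontal edges carry no hole-star. [folklore] -/
theorem hs_hEdge (p : Vtx N) : (lab N).hs (hEdge N p).val = none := by
  simp only [lab, (hEdge N p).isLt, dif_pos, fin_eta, edg_hEdge]
  simp

/-- Vertical edges carry no pigeon-star. [folklore] -/
theorem ps_vEdge (p : Vtx N) : (lab N).ps (vEdge N p).val = none := by
  simp only [lab, (vEdge N p).isLt, dif_pos, fin_eta, edg_vEdge]
  simp

/-- The hole-star of a vertical edge. [folklore] -/
theorem hs_vEdge (p : Vtx N) :
    (lab N).hs (vEdge N p).val = if p.2 ≠ 0 then some (p.2.val - 1, Finset.Icc p.1.val N) else none := by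
  simp only [lab, (vEdge N p).isLt, dif_pos, fin_eta, edg_vEdge, true_and]

/-- **The labelling is well formed.** [folklore] -/
theorem lab_wf : (lab N).WF N := by
  constructor
  · intro v b J h
    simp only [lab] at h
    split_ifs at h with h1 h2
    obtain ⟨rfl, rfl⟩ := Prod.mk.inj (Option.some.inj h)
    refine ⟨by have := (edg N ⟨v, h1⟩).2.1.isLt; omega, fun a ha => (Finset.mem_Ico.1 ha).2⟩
  · intro v a I h
    simp only [lab] at h
    split_ifs at h with h1 h2
    obtain ⟨rfl, rfl⟩ := Prod.mk.inj (Option.some.inj h)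
    have hc := (edg N ⟨v, h1⟩).2.2.isLt
    have hc0 : (edg N ⟨v, h1⟩).2.2.val ≠ 0 := fun e => h2.2 (Fin.ext e)
    exact ⟨by omega, fun b hb => by have := (Finset.mem_Icc.1 hb).2; omega⟩

/-! ### Values of the edges under a local bijection -/

/-- Value of a horizontal edge. [folklore] -/
theorem val_hEdge (f g : ℕ → ℕ) (p : Vtx N) :
    val (lab N) f g (hEdge N p).val =
      (decide (p.1 ≠ 0) && decide (f (p.1.val - 1) ∈ Finset.Ico p.2.val N)) := by
  simp only [val, pval, hval, lab]
  by_cases h : p.1 = 0 <;> simp [h]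

/-- Value of a vertical edge. [folklore] -/
theorem val_vEdge (f g : ℕ → ℕ) (p : Vtx N) :
    val (lab N) f g (vEdge N p).val =
      (decide (p.2 ≠ 0) && decide (g (p.2.val - 1) ∈ Finset.Icc p.1.val N)) := by
  simp only [val, pval, hval, lab]
  by_cases h : p.2 = 0 <;> simp [h]

/-! ### The support of a row and its variables -/

/-- `(1 : ZMod 2) ≠ 0`. [folklore] -/
theorem one_ne_zero_zmod2 : (1 : ZMod 2) ≠ 0 := by decide

/-- The support of a row is the set of the four incident edges. [folklore] -/
theorem supp_sys (i : Fin (nV N)) : (sys N i).supp = inc N (vtx N i) := by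
  ext j
  simp only [LinEqMod.supp, sys, Finset.mem_filter, Finset.mem_univ, true_and]
  by_cases h : j ∈ inc N (vtx N i) <;> simp [h]

/-- The rows are `4`-sparse. [folklore] -/
theorem card_supp_sys_le (i : Fin (nV N)) : (sys N i).supp.card ≤ 4 := by
  rw [supp_sys, inc]
  refine (Finset.card_insert_le _ _).trans ?_
  refine (Nat.succ_le_succ (Finset.card_insert_le _ _)).trans ?_
  refine (Nat.succ_le_succ (Nat.succ_le_succ (Finset.card_insert_le _ _))).trans ?_
  simp

/-- The variables of a row are (the values of) its incident edges. [folklore] -/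
theorem mem_eqVars_sys {i : Fin (nV N)} {e : Fin (nE N)} (he : e ∈ inc N (vtx N i)) :
    e.val ∈ eqVars 1 (sys N i) := by
  rw [mem_eqVars]
  refine ⟨e, by rwa [supp_sys], ?_⟩
  rw [mem_encBlock]
  exact ⟨0, by omega, by simp⟩

/-! ### Distinctness of the four edges at a vertex -/

/-- Horizontal and vertical edges differ. [folklore] -/
theorem hEdge_ne_vEdge (p q : Vtx N) : hEdge N p ≠ vEdge N q := by
  intro h
  have := congrArg (edg N) h
  rw [edg_hEdge, edg_vEdge] at this
  exact absurd (Prod.mk.inj this).1 (by decide)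

/-- `hEdge` is injective. [folklore] -/
theorem hEdge_injective : Function.Injective (hEdge N) := fun p q h => by
  have := congrArg (edg N) h
  rw [edg_hEdge, edg_hEdge] at this
  exact (Prod.mk.inj this).2

/-- `vEdge` is injective. [folklore] -/
theorem vEdge_injective : Function.Injective (vEdge N) := fun p q h => by
  have := congrArg (edg N) h
  rw [edg_vEdge, edg_vEdge] at this
  exact (Prod.mk.inj this).2

/-- On a cycle of length `≥ 2`, the predecessor differs. [folklore] -/
theorem sub_one_ne_self {k : ℕ} (hk : 1 ≤ k) (c : Fin (k + 1)) : c - 1 ≠ c := by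
  intro h
  have hv := congrArg Fin.val h
  rw [Fin.coe_sub_one] at hv
  split_ifs at hv with h0
  · rw [h0] at hv; simp at hv; omega
  · have : c.val ≠ 0 := fun e => h0 (Fin.ext e)
    omega

/-! ### Soundness -/

/-- Four Boolean indicators summed in `ZMod 2`. [folklore] -/
theorem sum_four_ite (b₁ b₂ b₃ b₄ : Bool) :
    ((if b₁ then (1 : ZMod 2) else 0) + ((if b₂ then 1 else 0) + ((if b₃ then 1 else 0) + (if b₄ then 1 else 0)))) =
      if ((b₁ ^^ b₂) ^^ (b₃ ^^ b₄)) then 1 else 0 := by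
  cases b₁ <;> cases b₂ <;> cases b₃ <;> cases b₄ <;> decide

/-- **The labelling is sound for the torus system** (`N ≥ 1`): at every vertex the four incident
values telescope to the charge under every local bijection consistent on the incident edges.
[cite: KrajicekProofComplexity2019, §15.4 (the substituted axioms are provable from ¬ontoPHP_n)] -/
theorem lab_sound (hN : 1 ≤ N) : PHPLabel.Sound (lab N) N (sys N) := by
  intro i f g hcons
  obtain ⟨h1, h2, -, -, h5⟩ := hcons
  set p := vtx N i with hp
  obtain ⟨r, c⟩ := p
  -- the four edges and their distinctness
  set e₁ := hEdge N (r, c) with he₁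
  set e₂ := hEdge N (r, c - 1) with he₂
  set e₃ := vEdge N (r, c) with he₃
  set e₄ := vEdge N (r - 1, c) with he₄
  have hinc : inc N (r, c) = {e₁, e₂, e₃, e₄} := rfl
  have h12 : e₁ ≠ e₂ := fun h => by
    have := hEdge_injective h
    exact sub_one_ne_self hN c (Prod.mk.inj this).2.symm
  have h13 : e₁ ≠ e₃ := hEdge_ne_vEdge _ _
  have h14 : e₁ ≠ e₄ := hEdge_ne_vEdge _ _
  have h23 : e₂ ≠ e₃ := hEdge_ne_vEdge _ _
  have h24 : e₂ ≠ e₄ := hEdge_ne_vEdge _ _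
  have h34 : e₃ ≠ e₄ := fun h => by
    have := vEdge_injective h
    exact sub_one_ne_self (by omega) r (Prod.mk.inj this).1.symm
  -- memberships of the edges among the variables of the row
  have hm : ∀ e ∈ ({e₁, e₂, e₃, e₄} : Finset (Fin (nE N))), e.val ∈ eqVars 1 (sys N i) := fun e he =>
    mem_eqVars_sys (by rw [← hp]; exact he)
  have hm₁ : e₁.val ∈ eqVars 1 (sys N i) := hm e₁ (by simp)
  have hm₃ : e₃.val ∈ eqVars 1 (sys N i) := hm e₃ (by simp)
  -- the consistency facts actually used
  have hf : r ≠ 0 → f (r.val - 1) < N := fun hr =>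
    h1 _ hm₁ (r.val - 1) (Finset.Ico c.val N) (by rw [he₁, ps_hEdge]; simp [hr])
  have hg : c ≠ 0 → g (c.val - 1) < N + 1 := fun hc =>
    h2 _ hm₃ (c.val - 1) (Finset.Icc r.val N) (by rw [he₃, hs_vEdge]; simp [hc])
  have hiff : r ≠ 0 → c ≠ 0 → (f (r.val - 1) = c.val - 1 ↔ g (c.val - 1) = r.val - 1) := fun hr hc =>
    h5 _ hm₁ _ hm₃ (r.val - 1) (Finset.Ico c.val N) (c.val - 1) (Finset.Icc r.val N)
      (by rw [he₁, ps_hEdge]; simp [hr]) (by rw [he₃, hs_vEdge]; simp [hc])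
  -- unfold the equation
  show (∑ j, (sys N i).1 j * (if val (lab N) f g j then 1 else 0)) = (sys N i).2
  simp only [sys, ← hp, ite_mul, one_mul, zero_mul, Finset.sum_ite_mem, Finset.univ_inter, hinc]
  rw [Finset.sum_insert (by simp [h12, h13, h14]), Finset.sum_insert (by simp [h23, h24]),
    Finset.sum_pair h34, he₁, he₂, he₃, he₄, val_hEdge, val_hEdge, val_vEdge, val_vEdge]
  dsimp only
  rw [sum_four_ite]
  -- the charge as a Boolean identity
  congr 1
  simp only [chgB]
  have hrv : (r - 1).val = if r = 0 then N + 1 else r.val - 1 := Fin.coe_sub_one r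
  have hcv : (c - 1).val = if c = 0 then N else c.val - 1 := Fin.coe_sub_one c
  by_cases hr : r = 0 <;> by_cases hc : c = 0
  · simp [hr, hc]
  · have hg' := hg hc
    simp only [hr, if_true] at hrv
    simp [hr, hc, Finset.mem_Icc]
    omega
  · have hf' := hf hr
    simp only [hc, if_true] at hcv
    simp [hr, hc]
    omega
  · have hf' := hf hr
    have hg' := hg hc
    have hi := hiff hr hc
    simp only [hr, hc, if_false] at hrv hcv
    have hr1 : r.val ≠ 0 := fun e => hr (Fin.ext e)
    have hc1 : c.val ≠ 0 := fun e => hc (Fin.ext e)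
    simp only [hr, hc, ne_eq, not_false_eq_true, decide_true, Finset.mem_Ico, Finset.mem_Icc, hrv, hcv,
      Bool.true_and, decide_false, Bool.false_and, Bool.or_false]
    -- Boolean bookkeeping: `[c ≤ f] ⊕ [c-1 ≤ f] = [f = c-1]`, `[r ≤ g] ⊕ [r-1 ≤ g] = [g = r-1]`
    rcases Nat.lt_or_ge (f (r.val - 1)) (c.val - 1) with hlt | hge
    · have hne : f (r.val - 1) ≠ c.val - 1 := by omega
      have hgne : g (c.val - 1) ≠ r.val - 1 := fun e => hne (hi.2 e)
      rcases Nat.lt_or_ge (g (c.val - 1)) (r.val - 1) with hl | hl <;>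
        simp [show ¬ (c.val ≤ f (r.val - 1)) by omega, show ¬ (c.val - 1 ≤ f (r.val - 1)) by omega, hf',
          show (r.val ≤ g (c.val - 1)) ↔ (r.val - 1 ≤ g (c.val - 1)) by omega]
    · rcases (Nat.eq_or_lt_of_le hge) with heq | hgt
      · have hgeq : g (c.val - 1) = r.val - 1 := hi.1 heq.symm
        have hcN : c.val - 1 < N := by omega
        have hrN : r.val - 1 ≤ N := by have := r.isLt; omega
        simp [heq.symm, hgeq, hcN, hrN, show ¬ (c.val ≤ c.val - 1) by omega,
          show ¬ (r.val ≤ r.val - 1) by omega]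
      · have hne : f (r.val - 1) ≠ c.val - 1 := by omega
        have hgne : g (c.val - 1) ≠ r.val - 1 := fun e => hne (hi.2 e)
        simp [show c.val ≤ f (r.val - 1) by omega, show c.val - 1 ≤ f (r.val - 1) by omega, hf',
          show (r.val ≤ g (c.val - 1)) ↔ (r.val - 1 ≤ g (c.val - 1)) by omega]

/-! ### The system is contradictory -/

/-- The row sum of a vertex, expanded over its four edges (`N ≥ 1`). [folklore] -/
theorem row_sum_eq (hN : 1 ≤ N) (z : Fin (nE N) → ZMod 2) (p : Vtx N) :
    (∑ j, (if j ∈ inc N p then (1 : ZMod 2) else 0) * z j) =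
      z (hEdge N p) + (z (hEdge N (p.1, p.2 - 1)) + (z (vEdge N p) + z (vEdge N (p.1 - 1, p.2)))) := by
  obtain ⟨r, c⟩ := p
  have h12 : hEdge N (r, c) ≠ hEdge N (r, c - 1) := fun h =>
    sub_one_ne_self hN c (Prod.mk.inj (hEdge_injective h)).2.symm
  have h34 : vEdge N (r, c) ≠ vEdge N (r - 1, c) := fun h =>
    sub_one_ne_self (by omega) r (Prod.mk.inj (vEdge_injective h)).1.symm
  simp only [ite_mul, one_mul, zero_mul, Finset.sum_ite_mem, Finset.univ_inter, inc]
  rw [Finset.sum_insert (by simp [h12, hEdge_ne_vEdge]), Finset.sum_insert (by simp [hEdge_ne_vEdge]),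
    Finset.sum_pair h34]

/-- Shifting a column is a bijection of the vertices. [folklore] -/
def shiftCol : Vtx N ≃ Vtx N where
  toFun p := (p.1, p.2 - 1)
  invFun p := (p.1, p.2 + 1)
  left_inv p := Prod.ext rfl (sub_add_cancel p.2 1)
  right_inv p := Prod.ext rfl (add_sub_cancel_right p.2 1)

/-- Shifting a row is a bijection of the vertices. [folklore] -/
def shiftRow : Vtx N ≃ Vtx N where
  toFun p := (p.1 - 1, p.2)
  invFun p := (p.1 + 1, p.2)
  left_inv p := Prod.ext (sub_add_cancel p.1 1) rfl
  right_inv p := Prod.ext (add_sub_cancel_right p.1 1) rfl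

/-- `x + x = 0` in `ZMod 2`. [folklore] -/
theorem add_self_zmod2 (x : ZMod 2) : x + x = 0 := by
  fin_cases x <;> decide

/-- **Summing all rows kills the left-hand sides**: every edge lies in exactly two rows.
[cite: KrajicekProofComplexity2019, §13.3 (Tseitin formulas: the sum of all constraints)] -/
theorem sum_rows_lhs (hN : 1 ≤ N) (z : Fin (nE N) → ZMod 2) :
    (∑ i, ∑ j, (sys N i).1 j * z j) = 0 := by
  have h1 : (∑ i, ∑ j, (sys N i).1 j * z j) =
      ∑ p : Vtx N, (z (hEdge N p) + (z (hEdge N (p.1, p.2 - 1)) + (z (vEdge N p) + z (vEdge N (p.1 - 1, p.2))))) := by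
    rw [← Equiv.sum_comp (vtx N)]
    exact Finset.sum_congr rfl fun i _ => row_sum_eq hN z (vtx N i)
  rw [h1, Finset.sum_add_distrib, Finset.sum_add_distrib, Finset.sum_add_distrib]
  have h2 : (∑ p : Vtx N, z (hEdge N (p.1, p.2 - 1))) = ∑ p : Vtx N, z (hEdge N p) :=
    Equiv.sum_comp (shiftCol (N := N)) (fun p => z (hEdge N p))
  have h3 : (∑ p : Vtx N, z (vEdge N (p.1 - 1, p.2))) = ∑ p : Vtx N, z (vEdge N p) :=
    Equiv.sum_comp (shiftRow (N := N)) (fun p => z (vEdge N p))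
  rw [h2, h3, ← add_assoc, add_self_zmod2, zero_add, add_self_zmod2]

/-- **Summing all rows leaves an odd right-hand side**: there are `2N + 1` charged vertices.
[cite: KrajicekProofComplexity2019, §13.3 (odd total charge)] -/
theorem sum_rows_rhs : (∑ i, (sys N i).2) = 1 := by
  have h1 : (∑ i, (sys N i).2) = ∑ p : Vtx N, (if chgB N p then (1 : ZMod 2) else 0) := by
    rw [← Equiv.sum_comp (vtx N)]; rfl
  rw [h1, Fintype.sum_prod_type]
  -- row `0` contributes `N`, every other row contributes `1`
  have hrow0 : (∑ c : Fin (N + 1), (if chgB N (0, c) then (1 : ZMod 2) else 0)) = (N : ZMod 2) := by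
    have : ∀ c : Fin (N + 1), (if chgB N (0, c) then (1 : ZMod 2) else 0) = if c ≠ 0 then 1 else 0 := by
      intro c; simp [chgB]
    simp_rw [this]
    rw [Finset.sum_boole, Finset.filter_ne', Finset.card_erase_of_mem (Finset.mem_univ _), Finset.card_univ,
      Fintype.card_fin]
    simp
  have hrow : ∀ r : Fin (N + 2), r ≠ 0 → (∑ c : Fin (N + 1), (if chgB N (r, c) then (1 : ZMod 2) else 0)) = 1 := by
    intro r hr
    have : ∀ c : Fin (N + 1), (if chgB N (r, c) then (1 : ZMod 2) else 0) = if c = 0 then 1 else 0 := by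
      intro c; simp [chgB, hr]
    simp_rw [this]
    rw [Finset.sum_ite_eq']; simp
  rw [Fin.sum_univ_succ, hrow0]
  have : (∑ r : Fin (N + 1), ∑ c : Fin (N + 1), (if chgB N (r.succ, c) then (1 : ZMod 2) else 0)) = (N + 1 : ℕ) := by
    rw [Finset.sum_congr rfl fun r _ => hrow r.succ (Fin.succ_ne_zero r)]
    simp
  rw [this]
  have e : ((N : ZMod 2) + ((N + 1 : ℕ) : ZMod 2)) = ((2 * N + 1 : ℕ) : ZMod 2) := by push_cast; ring
  rw [e]
  have h2 : (2 : ZMod 2) = 0 := by decide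
  push_cast
  rw [h2, zero_mul, zero_add]

/-- **The torus Tseitin system is unsatisfiable** (`N ≥ 1`), so the tautology whose proofs are
bounded below is a genuine one. [cite: KrajicekProofComplexity2019, §13.3 (Tseitin formulas with odd total charge are unsatisfiable)] -/
theorem sys_unsat (hN : 1 ≤ N) : ¬ SystemSat (sys N) Finset.univ := by
  rintro ⟨z, hz⟩
  have h : (∑ i, ∑ j, (sys N i).1 j * z j) = ∑ i, (sys N i).2 :=
    Finset.sum_congr rfl fun i _ => hz i (Finset.mem_univ i)
  rw [sum_rows_lhs hN, sum_rows_rhs] at h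
  exact absurd h (by decide)

/-! ### The lower bound -/

/-- **Bounded-depth Frege lower bound for Tseitin on torus grids** (Håstad 2020, Thm. 6.2, weak
exponent; here by Ben-Sasson's reduction to the bijective pigeonhole principle and Ajtai's theorem,
fully proved): for every depth `d` there are `ε > 0` and `N₀` such that for all `N ≥ N₀` every
depth-`d` `textbookFrege`-proof of the negated XOR-CNF of the charged `(N+2) × (N+1)` torus grid has
size at least `2^{N^ε}`. [cite: Hastad2020, Thm. 6.2 (statement, with exponent Ω(1/d); here ε_d)]
[cite: BenSasson2002, Thm. 1.1 (method: reduction of Tseitin formulas to the pigeonhole principle)]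
[cite: KrajicekProofComplexity2019, §15.4 and p. 431] -/
theorem depthFrege_lowerBound (d : ℕ) :
    ∃ ε : ℝ, 0 < ε ∧ ∃ N₀ : ℕ, ∀ N ≥ N₀, ∀ π : List (PropForm ℕ),
      textbookFrege.IsDepthProofOf d π (neg (PropForm.ofCNF (sumEncoding 1 (sys N)))) →
        (2 : ℝ) ^ ((N : ℝ) ^ ε) ≤ (proofSize π : ℝ) := by
  obtain ⟨ε, hε, N₀, h⟩ := depthFrege_lowerBound_of_sound_label 4 d
  refine ⟨ε, hε, max N₀ 1, fun N hN π hπ => ?_⟩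
  exact h N (le_of_max_le_left hN) _ _ (sys N) card_supp_sys_le (lab N) lab_wf
    (lab_sound (le_of_max_le_right hN)) π hπ

end TorusGrid

end OntoPHPReduction

end Literature.Computability.MetaComplexity
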